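import Literature.AlgebraicGeometry.Resolution.Lipman1969RationalSurfaceSingularities
import Mathlib.AlgebraicGeometry.Pullbacks
import Mathlib.RingTheory.Flat.Basic
import Mathlib.RingTheory.LocalRing.ResidueField.Basic
import HarnessLib

/-!
# Desingularizations and rational singularities under formally smooth local base change
# (Lipman 1969, Lemma (16.1) (ii) and Proposition (16.5))

Topic: `Literature/AlgebraicGeometry/Resolution`. NAMED FACTS (D-0014), typed from the printed pages of
J. Lipman, *Rational singularities, with applications to algebraic surfaces and unique
factorization*, Publ. Math. IHÉS 36 (1969) 195–279, §16 "Formally smooth extensions" (held copy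
`paper:doi-10-1007-bf02684604`, read on the page: PDF pp. 38–43 = printed pp. 231–236), in the
vocabulary of `Lipman1969RationalSurfaceSingularities` (`IsResolution`, `HasRationalSingularity`)
and Mathlib (`Module.Flat`, `IsLocalHom`, `IsLocalRing.ResidueField`, `Algebra.IsSeparable`, the fibre
product `Limits.pullback` of schemes).

## The source (quoted from the printed paper)

**Lemma (16.1)** (p. 231). "Let `A` be a reduced local ring, with maximal ideal `𝔪`, such that there
exists a desingularization `g : Y → Spec(A)`. Let `B` be a local ring, and let `φ : A → B` be a local
homomorphism such that, with `A` and `B` topologized by the powers of their respective maximal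
ideals, `B` is a formally smooth `A`-algebra (1). Let `A'` be the integral closure of `A` in its total
ring of fractions `T_A`, and let `B'`, `T_B`, be similarly defined. Then (i) `A'` is a finitely
generated `A`-module. (ii) `B` is reduced and the projection `g_B : Z = Y ⊗_A B → Spec(B)` is a
desingularization. (iii) With canonical identifications we have `B = A ⊗_A B ⊆ A' ⊗_A B ⊆ T_A ⊗_A B
⊆ T_B` and then `A' ⊗_A B = B'`." Footnote (1): "For our purposes this can be taken to mean that `B`
is flat over `A` and that `B/𝔪B` is geometrically regular over `A/𝔪` (cf. [EGA 0_IV, (19.7.1) and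
(22.5.8)])."

**Proposition (16.3)** (p. 233), first sentence: "Suppose that `A` and `B` satisfy the hypotheses of
Lemma (16.1) and that furthermore both are two-dimensional (so that `𝔪B` is the maximal ideal of `B`
and `B/𝔪B` is a separable field extension of `A/𝔪`). If either one of `A` or `B` is normal then so is
the other, …" (the remaining assertion of (16.3), on the diagram of §15 and regular extensions, is
not typed; cf. the author's "Correction (added in proof)", p. 279, which concerns that last
statement only).

**Proposition (16.5)** (p. 235). "Let `A`, `B` be as in Proposition (16.3). If either one of `A` or
`B` is normal then so is the other, and then `A` has a rational singularity if and only if `B` has a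
rational singularity." (Proof, p. 235: "If `A` has a rational singularity then there is a
desingularization `g : Y → Spec(A)` with `H¹(Y, 𝒪_Y) = 0`. Then `g_B : Z = Y ⊗_A B → Spec(B)` is a
desingularization of `B` (Lemma (16.1)) and since `B` is flat over `A`, `H¹(Z, 𝒪_Z) = H¹(Y, 𝒪_Y) ⊗_A B
= 0`. …" and conversely by descending a sequence of quadratic transformations, pp. 235–236.)

## What is vendored, and in which vocabulary

The facts are typed for the following SPECIAL CASE of Lipman's hypotheses (the "local-étale /
unramified formally smooth" case, which is the one met when the residue field is extended separably,
e.g. along a finite étale local `A`-algebra or a (strict) henselization):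

  `A`, `B` Noetherian local rings, `A → B` a LOCAL homomorphism (`Algebra A B`,
  `IsLocalHom (algebraMap A B)`) which is FLAT (`Module.Flat A B`) with `𝔪_A B = 𝔪_B`
  (`(maximalIdeal A).map (algebraMap A B) = maximalIdeal B`) and `κ(B)/κ(A)` a separable ALGEBRAIC
  extension (`Algebra.IsSeparable (ResidueField A) (ResidueField B)`).

Then `B/𝔪B = κ(B)` is a field, separable algebraic — hence geometrically regular — over `A/𝔪 = κ(A)`,
so with flatness "`B` is a formally smooth `A`-algebra" in the sense of footnote (1) of (16.1); and
`dim B = dim A + dim B/𝔪B = dim A` (flat local), so for `dim A = 2` both rings are two-dimensional as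
(16.3)/(16.5) require. Lipman's standing conventions (§0: all rings noetherian) are part of the bundle.

* `Lipman1969_16_1_ii` — Lemma (16.1) (ii) in this case: for `A` reduced with a desingularization
  `g : Y → Spec A` (`IsResolution`: proper, birational, `Y` regular), `B` is reduced and the base
  change `g_B : Y ×_{Spec A} Spec B → Spec B` (Mathlib `Limits.pullback.snd g (Spec B → Spec A)`) is a
  desingularization of `Spec B`.
* `Lipman1969_16_5` — Proposition (16.5) in this case, with `dim A = dim B = 2` and (16.1)'s standing
  hypothesis that `Spec A` admits a desingularization: `A` is normal iff `B` is normal ("normal" =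
  integrally closed domain: `IsDomain ∧ IsIntegrallyClosed`), and when they are, `A` has a rational
  singularity iff `B` has (`HasRationalSingularity`, Definition (1.1)).

VACUITY: the hypothesis bundle is satisfiable and non-trivial (e.g. `B = A`; `B` a finite étale local
`A`-algebra `(A[T]/(f))_𝔫` with `f` monic, separable modulo `𝔪`; `B = A^h`, `A^{sh}`, or `Â` when
`κ` is perfect — all flat, unramified, with separable algebraic residue extension), and neither `Prop`
reduces to `True`/`False` by unfolding: both conclude structural statements (`IsResolution` of a
pullback, `HasRationalSingularity B`) that are not among the hypotheses.

## What is NOT here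

The proofs; (16.1) (i) and (iii) (finiteness of the normalization, `A' ⊗_A B = B'`); the general
formally smooth case of (16.1)/(16.5) (`B/𝔪B` geometrically regular of positive dimension, e.g.
`B = A[T]_{𝔪A[T]}`, or residue extensions that are separable but not algebraic); Proposition (16.3)
beyond its normality clause (the diagram of §15, Lemma (16.4)); the behaviour of exceptional curves
under `σ : Z → Y` (p. 233: "each integral curve `E` with exceptional support on `Z` dominates a unique
such curve `σ(E)` on `Y`"). `-- TODO(general form)` lines record the printed generality. Consumers:
the crux chain W4.4 (`HomologicalConductor`, `NoZenoR`) of the summit `ResolutionOfSingularities`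
(base change of a minimal desingularization to a residue-splitting local-étale neighbourhood);
nothing here depends on that summit. Mathlib searched (pin): `Module.Flat`, `IsLocalHom`,
`IsLocalRing.ResidueField` and its `Algebra (ResidueField A) (ResidueField B)` instance for local
homomorphisms, `Algebra.IsSeparable`, `Limits.pullback.snd`, `Spec.map` (all used); Mathlib has
`Algebra.FormallySmooth` (discrete topologies) but not EGA's adic formal smoothness, which is why the
bundle is spelled out.

## References

* J. Lipman, *Rational singularities, with applications to algebraic surfaces and unique
  factorization*, Publ. Math. IHÉS 36 (1969) 195–279: §16, Lemma (16.1) (p. 231, proof p. 232),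
  Prop. (16.3) (p. 233), Prop. (16.5) (p. 235, proof pp. 235–236); §0 (p. 198); Def. (1.1) (p. 199);
  Correction (p. 279). [Lipman1969]
* A. Grothendieck, J. Dieudonné, EGA 0_IV (19.7.1), (22.5.8) (formal smoothness; Lipman's footnote).
  [EGA0IV]
-/

noncomputable section

open CategoryTheory AlgebraicGeometry TopologicalSpace IsLocalRing

universe u

namespace Literature.AlgebraicGeometry.Resolution

/-! ## Lemma (16.1) (ii): desingularizations pull back along local-étale formally smooth base change -/

/-- NAMED FACT — **Lipman 1969, Lemma (16.1) (ii)**: "Let `A` be a reduced local ring, with maximal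
ideal `𝔪`, such that there exists a desingularization `g : Y → Spec(A)`. Let `B` be a local ring, and
let `φ : A → B` be a local homomorphism such that … `B` is a formally smooth `A`-algebra [footnote: for
our purposes this can be taken to mean that `B` is flat over `A` and that `B/𝔪B` is geometrically
regular over `A/𝔪`]. … Then … (ii) `B` is reduced and the projection `g_B : Z = Y ⊗_A B → Spec(B)` is a
desingularization." Rendered in the special case `𝔪_A B = 𝔪_B` with `κ(B)/κ(A)` separable algebraic
(then `B/𝔪B = κ(B)` is geometrically regular over `κ(A)`), `A`, `B` Noetherian (§0), `A → B` local and
flat: for every desingularization `g : Y → Spec A` (`IsResolution`: proper, birational, `Y` regular) of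
the reduced `A`, the ring `B` is reduced and `g_B : Y ×_{Spec A} Spec B → Spec B`
(`Limits.pullback.snd g (Spec.map (A → B))`) is a desingularization of `Spec B`. Users take
`(h : Lipman1969_16_1_ii)`. [cite: Lipman1969, Lemma (16.1) (ii) (p. 231; proof p. 232)] -/
def Lipman1969_16_1_ii : Prop :=
  ∀ (A B : Type u) [CommRing A] [CommRing B] [IsNoetherianRing A] [IsNoetherianRing B]
    [IsLocalRing A] [IsLocalRing B] [Algebra A B] [IsLocalHom (algebraMap A B)] [Module.Flat A B],
    IsReduced A →
    (maximalIdeal A).map (algebraMap A B) = maximalIdeal B →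
    Algebra.IsSeparable (ResidueField A) (ResidueField B) →
    ∀ (Y : Scheme.{u}) (g : Y ⟶ Spec (.of A)), IsResolution g →
      IsReduced B ∧
        IsResolution (Limits.pullback.snd g (Spec.map (CommRingCat.ofHom (algebraMap A B))))
-- TODO(general form): Lipman proves (16.1) for every local homomorphism `A → B` making `B` a
-- formally smooth `A`-algebra for the adic topologies (flat with `B/𝔪B` geometrically regular over
-- `A/𝔪`, of any dimension), together with (i) `A'` finite over `A` and (iii) `A' ⊗_A B = B'`.

/-! ## Proposition (16.5): normality and rationality are invariant -/

/-- NAMED FACT — **Lipman 1969, Proposition (16.5)**: "Let `A`, `B` be as in Proposition (16.3)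
[i.e. as in Lemma (16.1) and both two-dimensional, "so that `𝔪B` is the maximal ideal of `B` and
`B/𝔪B` is a separable field extension of `A/𝔪`"]. If either one of `A` or `B` is normal then so is
the other, and then `A` has a rational singularity if and only if `B` has a rational singularity."
Rendered in the special case of `Lipman1969_16_1_ii` (`A`, `B` Noetherian local, `A → B` local and
flat, `𝔪_A B = 𝔪_B`, `κ(B)/κ(A)` separable algebraic), with `A` reduced admitting a desingularization
(the standing hypothesis of (16.1)) and `dim A = dim B = 2` (`ringKrullDim`): `A` is normal iff `B`
is normal — "normal" for a local ring meaning an integrally closed domain (`IsDomain`,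
`IsIntegrallyClosed`) — and, when they are normal, `A` has a rational singularity iff `B` has
(`HasRationalSingularity`, Definition (1.1)). The direction "`A` rational ⇒ `B` rational" is (16.1)
with flat base change of `H¹` (p. 235); the converse descends quadratic transformations
(pp. 235–236). Users take `(h : Lipman1969_16_5)`.
[cite: Lipman1969, Proposition (16.5) (p. 235; proof pp. 235–236)] -/
def Lipman1969_16_5 : Prop :=
  ∀ (A B : Type u) [CommRing A] [CommRing B] [IsNoetherianRing A] [IsNoetherianRing B]
    [IsLocalRing A] [IsLocalRing B] [Algebra A B] [IsLocalHom (algebraMap A B)] [Module.Flat A B],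
    IsReduced A →
    (maximalIdeal A).map (algebraMap A B) = maximalIdeal B →
    Algebra.IsSeparable (ResidueField A) (ResidueField B) →
    ringKrullDim A = 2 → ringKrullDim B = 2 →
    (∃ (Y : Scheme.{u}) (g : Y ⟶ Spec (.of A)), IsResolution g) →
      ((IsDomain A ∧ IsIntegrallyClosed A) ↔ (IsDomain B ∧ IsIntegrallyClosed B)) ∧
        ((IsDomain A ∧ IsIntegrallyClosed A) →
          (HasRationalSingularity A ↔ HasRationalSingularity B))
-- TODO(general form): Lipman states (16.5) for `B` formally smooth over `A` (adic topologies) with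
-- `dim A = dim B = 2`; Proposition (16.3) adds the commutative diagram of the exact sequences of §15
-- for `A` and `B` (not typed).

end Literature.AlgebraicGeometry.Resolution

end
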